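import Summits.PneNP.PneNP.Theses.PhaseTwins
import Summits.PneNP.PneNP.Theorems.NPNotSubsetPPoly
import Literature.Computability.Complexity.HardcoreInapproximability
import Literature.Computability.Complexity.ProbabilisticClassesProofs
import Literature.Computability.Complexity.CircuitClassesUniformProofs
import Literature.Computability.Complexity.StockmeyerMachines
import Literature.Computability.Complexity.OracleEmptyFP
import Literature.Computability.Complexity.OracleComposition
import Literature.Computability.Complexity.OracleCompositionMachine
import Literature.Computability.Complexity.OracleProofs
import Literature.Computability.Complexity.LazySamplingMachine
import Literature.Computability.Cryptography.CryptoFoundationsOneWayFunctionsProofs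
import Literature.Barriers.PneNP.Relativization
import Literature.Barriers.PneNP.BoundedRelativization
import Literature.Barriers.PneNP.RelativizationProofs
import Literature.Barriers.PneNP.BoundedRelativizationProofs

/-!
# Sketch (crux-ideate, ideator 1, round 1) — crux stmt-PneNP-2717 `PhaseTwins.NoFBPPApproxAboveUniqueness`

Card `stockmeyer-bpp-calibration`: the crux X is `NP ⊄ BPP` in hard-core costume.

* `ApproxBody O Δ p q` — the negated body of X at `(Δ, p, q)`, relative to an oracle `O`
  (`FP` ↦ `FP^O`); `XRel O` — the oracle-indexed shape of X; `X_iff_XRel_empty` — anchor.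
* (N, negative lane) `not_X_of_NP_subset_BPP : HardcoreCountSharpP → NP ⊆ BPP → ¬ X`, from the ONE
  lever stub `hasFPRAS_of_sharpP_of_NP_subset_BPP` (oracle-free Stockmeyer: `BPP^{BPP} = BPP` inside
  the tree's Stockmeyer transducer) + the proved plumbing `approxBody_empty_of_hasFPRAS`.
* (P, positive conditional) `X_of_NP_ne_RP : NP_eq_RP_of_hardcoreFPRAS → NP ≠ RP → X` (GŠV16 Thm 1,
  vendored fact) from the plumbing stub `hasFPRAS_of_approxBody_empty` (drop the padding slot).
* (C) `X_iff_not_NP_subset_BPP` — the calibration; feeders `X_of_OWFExist`, `X_of_NPNotSubsetPPoly`.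
* (B, barrier instance, PROVED here modulo nothing) `not_XRel_of_collapse`: at every oracle `A` with
  `P^A = NP^A` the relativised crux fails (the route's Stockmeyer assembly run at `A` instead of `∅`);
  hence `¬ Relativizes XRel` (BGS) and `¬ CRelativizes PSPACE XRel` (Hirahara–Lu–Ren bounded
  relativization) from the catalogued barrier facts.
-/

namespace Summit.PneNP.PneNP.Cruxes.NoFBPPApproxAboveUniqueness.SketchIdeator1

open Literature.Computability.Complexity Literature.Probability.LatticeModels
open Summit.PneNP.PneNP.Theses.PhaseTwins

/-- The negated body of the crux at `(Δ, p, q)`, relative to an oracle `O` (at `O = ∅` and with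
`FP^∅ = FP` it is literally the `¬`-scope of `NoFBPPApproxAboveUniqueness`). -/
def ApproxBody (O : Oracle) (Δ p q : ℕ) : Prop :=
  ∃ F ∈ FPRel O, ∃ c r : Polynomial ℕ, ∀ (x : List Bool) (kη kδ : ℕ), 0 < kη → 0 < kδ →
    uniformProb (c.eval (x.length + r.eval x.length + kη + kδ))
      {u | ¬ IsApproxCount kη (hardcoreCount Δ p q x)
        (countEstimate F x (r.eval x.length) kη kδ u)} ≤ 1 / (kδ : ℝ)

/-- Oracle-indexed shape of the crux: `O ↦ X^O`. -/
def XRel (O : Oracle) : Prop :=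
  ∃ Δ p q : ℕ, 3 ≤ Δ ∧ 0 < q ∧ hardCoreThreshold Δ < (p : ℝ) / q ∧ ¬ ApproxBody O Δ p q

/-- Anchor: the crux is the empty-oracle instance of `XRel`. -/
theorem X_iff_XRel_empty : NoFBPPApproxAboveUniqueness ↔ XRel Oracle.empty := by
  unfold NoFBPPApproxAboveUniqueness XRel ApproxBody
  rw [FPRel_empty_eq]
  rfl

/-- **One-sidedness of relativization for this crux**: the counting problem is not relativised, the
oracle only helps the approximator (`FP ⊆ FP^O`), so `O ↦ X^O` is antitone and `X^O → X` for every `O` —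
an oracle at which the relativised crux HOLDS would prove the crux outright. PROVED. -/
theorem X_of_XRel (O : Oracle) (h : XRel O) : NoFBPPApproxAboveUniqueness := by
  rw [X_iff_XRel_empty]
  obtain ⟨Δ, p, q, hΔ, hq, hthr, hno⟩ := h
  refine ⟨Δ, p, q, hΔ, hq, hthr, fun hbody => hno ?_⟩
  obtain ⟨F, hF, c, r, hc⟩ := hbody
  refine ⟨F, OracleAlg.FP_subset_FPRel_core O (by rw [← FPRel_empty_eq]; exact hF), c, r, hc⟩

/-! ### Plumbing between the padded FBPP body and `HasFPRAS` -/

/-- `HasFPRAS N ⟹` the padded body (take `r := 0`). PROVED. -/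
theorem approxBody_empty_of_hasFPRAS {Δ p q : ℕ} (h : HasFPRAS (hardcoreCount Δ p q)) :
    ApproxBody Oracle.empty Δ p q := by
  obtain ⟨F, hF, c, hc⟩ := h
  refine ⟨F, by rw [FPRel_empty_eq]; exact hF, c, 0, fun x kη kδ hη hδ => ?_⟩
  simpa using hc x kη kδ hη hδ

/-- Padded body `⟹ HasFPRAS N`: the transducer `⟨x, 1⁰, 1^{kη}, 1^{kδ}, u⟩ ↦ F ⟨x, 1^{r|x|}, 1^{kη},
1^{kδ}, u ↾ c(…)⟩` with coin budget `c' = c ∘ (X + r ∘ X)` (monotonicity of `ℕ`-polynomials and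
`uniformProb_mono_len`). Plumbing stub (M) — DISCHARGED in the crux's `Disproof.lean` gen 1
(`hasFPRAS_of_hasFPRASPadded`, brick algebra, 0 sorries; not importable here because crux workfiles are
not built modules on the farm). -/
theorem hasFPRAS_of_approxBody_empty {Δ p q : ℕ} (h : ApproxBody Oracle.empty Δ p q) :
    HasFPRAS (hardcoreCount Δ p q) := by
  sorry

/-! ### THE LEVER: oracle-free Stockmeyer under `NP ⊆ BPP` (`BPP^{BPP} = BPP` inside the transducer) -/

/-- If `NP ⊆ BPP` then every `#P` function has an FPRAS in the tree's `HasFPRAS` format: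
`stockmeyerApproxCounting_holds ∅ R` gives `L ∈ NP`, `F ∈ FP^L`, coin budget `c`, failure `≤ 1/kδ`;
with `L ∈ BPP` replace every oracle call by the error-reduced `BPP` machine on fresh coins
(union bound as in `AdaptiveBPPSimulation.lean`, error `≤ 1/8`), call Stockmeyer at confidence `8`,
total error `≤ 1/4` = `ThreeQuartersFPRAS`, then `ThreeQuartersFPRAS.hasFPRAS` (JVV powering, PROVED).
Stub (M–L). NOTE: no general `OracleAlg` simulation is needed — the tree's counter
`StockMachine.counter R = ttFn qryF ((X+1)^2) outG (threshLang R)` is a non-adaptive truth-table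
function and `ttFn Q q G = adFn (Q ∘ ⟨x,bits⟩ ↦ ⟨x,1^{|bits|}⟩) q G` (`ttBits = adBits` by induction), so
`AdBPPSim.exists_randAlg_adFn` (PROVED) applies verbatim once `threshLang R ∈ NP ⊆ BPP`; remaining
work: its `7/8`-error variant, the coin-splitting transducer in `FP` (brick algebra), block probability. -/
theorem hasFPRAS_of_sharpP_of_NP_subset_BPP (hNP : Nondeterministic.NP ⊆ BPP)
    {N : List Bool → ℕ} (hN : N ∈ SharpP) : HasFPRAS N := by
  sorry

/-! ### Negative lane: `NP ⊆ BPP ⟹ ¬X` -/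

/-- **Theorem N.** `HardcoreCountSharpP → NP ⊆ BPP → ¬ NoFBPPApproxAboveUniqueness`. -/
theorem not_X_of_NP_subset_BPP (hS : HardcoreCountSharpP) (hNP : Nondeterministic.NP ⊆ BPP) :
    ¬ NoFBPPApproxAboveUniqueness := by
  rw [X_iff_XRel_empty]
  rintro ⟨Δ, p, q, -, -, -, hno⟩
  exact hno (approxBody_empty_of_hasFPRAS (hasFPRAS_of_sharpP_of_NP_subset_BPP hNP (hS Δ p q)))

/-! ### Positive conditional line: `NP ≠ RP ⟹ X` through the vendored GŠV16 Theorem 1 -/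

/-- **Theorem P.** Witness `(Δ, p, q) = (3, 5, 1)`: `λ_c(𝕋₃) = 4 < 5`. -/
theorem X_of_NP_ne_RP (hGSV : NP_eq_RP_of_hardcoreFPRAS) (hNP : Nondeterministic.NP ≠ RP) :
    NoFBPPApproxAboveUniqueness := by
  rw [X_iff_XRel_empty]
  have hthr : hardCoreThreshold 3 < ((5 : ℕ) : ℝ) / (1 : ℕ) := by norm_num [hardCoreThreshold]
  refine ⟨3, 5, 1, le_rfl, Nat.one_pos, hthr, fun hbody => ?_⟩
  exact hNP (hGSV 3 5 1 le_rfl Nat.one_pos hthr (hasFPRAS_of_approxBody_empty hbody))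

theorem X_of_not_NP_subset_BPP (hGSV : NP_eq_RP_of_hardcoreFPRAS)
    (h : ¬ Nondeterministic.NP ⊆ BPP) : NoFBPPApproxAboveUniqueness :=
  X_of_NP_ne_RP hGSV fun heq => h (by rw [heq]; exact RP_subset_BPP_holds)

/-! ### Calibration: X ⟺ NP ⊄ BPP (modulo the route's support item and the vendored fact) -/

/-- **Theorem C.** -/
theorem X_iff_not_NP_subset_BPP (hS : HardcoreCountSharpP) (hGSV : NP_eq_RP_of_hardcoreFPRAS) :
    NoFBPPApproxAboveUniqueness ↔ ¬ (Nondeterministic.NP ⊆ BPP) :=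
  ⟨fun hX hNP => not_X_of_NP_subset_BPP hS hNP hX, X_of_not_NP_subset_BPP hGSV⟩

/-- Feeder: one-way functions ⟹ X (tree theorem `NP_not_subset_BPP_of_OWFExist_holds`). -/
theorem X_of_OWFExist (hGSV : NP_eq_RP_of_hardcoreFPRAS)
    (h : Literature.Computability.Cryptography.OWFExist) : NoFBPPApproxAboveUniqueness :=
  X_of_not_NP_subset_BPP hGSV
    (Literature.Computability.Cryptography.NP_not_subset_BPP_of_OWFExist_holds h)

/-- Feeder: route Circuit's leaf `NP ⊄ P/poly ⟹ X` (Adleman, `BPP_subset_PPoly_holds`). -/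
theorem X_of_NPNotSubsetPPoly (hGSV : NP_eq_RP_of_hardcoreFPRAS)
    (h : Summit.PneNP.PneNP.NPNotSubsetPPoly) : NoFBPPApproxAboveUniqueness :=
  X_of_not_NP_subset_BPP hGSV fun hNP => h (hNP.trans BPP_subset_PPoly_holds)

/-! ### Barrier instance: the oracle-indexed crux fails at every collapsing oracle -/

/-- The route's Stockmeyer assembly, run at an oracle `A` with `NP^A ⊆ P^A`: the relativised
approximator exists. PROVED (no stub). -/
theorem approxBody_of_collapse {A : Language Bool}
    (hA : NPRel (Oracle.ofLanguage A) ⊆ PRel (Oracle.ofLanguage A))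
    {Δ p q : ℕ} (hN : hardcoreCount Δ p q ∈ SharpP) :
    ApproxBody (Oracle.ofLanguage A) Δ p q := by
  obtain ⟨R, hR, r, hcount⟩ := hN
  have hRO : R ∈ PRel (Oracle.ofLanguage A) := P_subset_PRel_holds _ hR
  obtain ⟨L, hL, F, hF, c, hc⟩ :=
    StockMachine.stockmeyerApproxCounting_holds (Oracle.ofLanguage A) R hRO
  have hFO : F ∈ FPRel (Oracle.ofLanguage A) :=
    OracleAlg.FPRel_subset_FPRel_of_mem_FPRel
      (OracleAlg.ofLanguage_mem_FPRel_of_mem_PRel (hA hL)) hF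
  refine ⟨F, hFO, c, r, fun x kη kδ hη hδ => ?_⟩
  have h := hc x (r.eval x.length) kη kδ hη hδ
  rw [← hcount x] at h
  exact h

/-- **Theorem B.** `X^A` fails at every oracle with `P^A = NP^A`. -/
theorem not_XRel_of_collapse {A : Language Bool}
    (hA : PRel (Oracle.ofLanguage A) = NPRel (Oracle.ofLanguage A)) (hS : HardcoreCountSharpP) :
    ¬ XRel (Oracle.ofLanguage A) := by
  rintro ⟨Δ, p, q, -, -, -, hno⟩
  exact hno (approxBody_of_collapse (fun L hL => by rw [hA]; exact hL) (hS Δ p q))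

/-- No relativizing proof of the crux (Baker–Gill–Solovay, catalogued fact `Relativization`). -/
theorem not_relativizes_XRel (h : Literature.Barriers.PneNP.Relativization)
    (hS : HardcoreCountSharpP) : ¬ Literature.Barriers.PneNP.Relativizes XRel := by
  obtain ⟨A, B, hA, -⟩ := h
  exact fun hrel => not_XRel_of_collapse hA hS (hrel A)

/-- No `PSPACE`-relativizing proof of the crux (Hirahara–Lu–Ren; catalogued fact
`BoundedRelativization`): `IP = PSPACE`-type arithmetization does not suffice either. -/
theorem not_cRelativizes_PSPACE_XRel (h : Literature.Barriers.PneNP.BoundedRelativization)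
    (hS : HardcoreCountSharpP) : ¬ Literature.Barriers.PneNP.CRelativizes PSPACE XRel := by
  obtain ⟨A, hA, hPA⟩ := h
  exact fun hrel => not_XRel_of_collapse hPA hS (hrel A hA)

/-- **Unconditional forms** (the catalogued facts are PROVED in the tree: `Relativization_holds`,
`BoundedRelativization_holds`): modulo the route's routine support item `HardcoreCountSharpP`, the crux
has no relativizing and no `PSPACE`-relativizing proof. -/
theorem not_relativizes_XRel' (hS : HardcoreCountSharpP) : ¬ Literature.Barriers.PneNP.Relativizes XRel :=
  not_relativizes_XRel Literature.Barriers.PneNP.Relativization_holds hS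

theorem not_cRelativizes_PSPACE_XRel' (hS : HardcoreCountSharpP) :
    ¬ Literature.Barriers.PneNP.CRelativizes PSPACE XRel :=
  not_cRelativizes_PSPACE_XRel Literature.Barriers.PneNP.BoundedRelativization_holds hS

end Summit.PneNP.PneNP.Cruxes.NoFBPPApproxAboveUniqueness.SketchIdeator1
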